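import Literature.NumberTheory.ComplexMultiplication.ReflexNormPointsNormRelation
import Literature.NumberTheory.ComplexMultiplication.ReflexNormPointsTransitivity
import Literature.NumberTheory.ComplexMultiplication.ReflexNormIdelesTransitivity
import Literature.NumberTheory.ComplexMultiplication.ReflexNormArtinMap
import HarnessLib

/-!
# The reflex norm of the `τ`-swapped CM type: `N_{E,Φ^τ̄} = N_{E,Φ} · (c(N′)/N′)^j`, `N′ = N_{E/L}` (S4b-2 of the I-1′ receptacle)

Layer `Literature/NumberTheory/ComplexMultiplication`.  THEOREMS ONLY (no def, no fact, no instance; net debt 0).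

SETTING.  `j : L → M` an embedding of number fields (`M` a CM field, `c = ` complex conjugation of `M`), `E ⊂ ℂ` a
number field which is an `L`-algebra through an embedding `τ : L → E ⊂ ℂ`, `Φ` a CM type of `M` containing EVERY
extension of `τ` along `j` («`τ`-adapted», the I-1′ receptacle's `IsExtAdapted τ j Φ`), and `Ψ = Φ^τ̄` the CM type
obtained from `Φ` by trading the block of embeddings over `τ` for the block over `τ̄ = conj ∘ τ`
(`ρ ∈ Ψ ↔ (ρ ∈ Φ ∧ ρ∘j ≠ τ) ∨ ρ∘j = τ̄`); `E ⊇ E*(Φ), E*(Ψ)`.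

WHAT IS PROVED — [MilneCM2006] Ch. I §1 Rem. 1.24/1.25 bookkeeping for the pair `(Φ, Ψ)`, on `R`-points for EVERY
commutative `ℚ`-algebra `R` and then on finite idèles:
* §1 the RELATIVE REGULAR module `V_τ = E ⊗_L M` (`E`-module, `M` acting on the right factor): its `E`-trace is
  `Tr_E(a | V_τ) = τ(Tr_{M/L} a) = Σ_{ρ∘j=τ} ρ(a)` and its coordinate determinant over `M` on `R`-points is
  `det_{M⊗R}(x | V_τ ⊗ R) = (1 ⊗ j)(Nm_{E/L}(R)(x))` (★ `normPoints L E R`);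
* §2 the TRACE IDENTITY `Tr(V_Φ) + Tr(V_τ^c) = Tr(V_Ψ) + Tr(V_τ)` (`V_τ^c` = `V_τ` with the `M`-action twisted by `c`,
  trace `Σ_{ρ∘j=τ̄} ρ(a)`): as multisets `Φ + {ρ∘j = τ̄} = Ψ + {ρ∘j = τ}`;
* §3 hence (★ Prop. 1.21 uniqueness `exists_equiv_of_trace_eq`) `V_Φ ⊕ V_τ^c ≅ V_Ψ ⊕ V_τ` as `M ⊗ E`-modules and,
  taking `det_{M⊗R}` (★ `baseChangeDet_prod`, `baseChangeDet_twist`, `baseChangeDet_basisMap`): on `R`-points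
  **`N_{E,Φ}(R)(x) · (1 ⊗ c∘j)(Nm_{E/L}(R) x) = N_{E,Ψ}(R)(x) · (1 ⊗ j)(Nm_{E/L}(R) x)`** (`reflexNormPoints_swap`) —
  Milne's (60)–(61) for `μ = [τ̄] − [τ]`: `N_Ψ/N_Φ = c(N′)/N′` read through `j`.
The finite-idèle form (`R = 𝔸_{ℚ,f}`; ★ `reflexNormFiniteIdele`, ★ `finiteIdeleRelNorm`, ★ `recipFactor`) is the
consumer's (T3 v4 `stub_S4`, A-p04) one-line specialisation.  HC_CM is proved only modulo the 7 printed citations until rung 0 closes.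

## References
* [MilneCM2006] J. S. Milne, *Complex Multiplication* (2006/2020), Ch. I §1 Prop. 1.21, Prop. 1.23, Rem. 1.24, Rem. 1.25.
* [Milne2005ShimuraVarieties] J. S. Milne, *Introduction to Shimura varieties*, Def. 12.8 (60)–(62) p. 114.
-/

set_option autoImplicit false

noncomputable section

open scoped TensorProduct IntermediateField NumberField NumberField.AdeleRing

namespace Literature.NumberTheory.ComplexMultiplication

open Literature.AlgebraicGeometry.GaoUllmo2025
open Literature.AlgebraicGeometry.Motives (CMType)
open Literature.NumberTheory.AdelicBaseChange
open Module ActionSpace IsDedekindDomain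

/-! ### §1. The relative regular module `V_τ = E ⊗_L M`: trace over `E`, coordinate determinant over `M` -/

section RelReg

variable {L : Type} [Field L] {E : Type} [Field E] [Algebra L E] {M : Type} [Field M] [Algebra L M]

/-- **`Tr_E(a | E ⊗_L M) = Tr_{M/L}(a)` in `E`**: for the action `ρ` of `M` on `V_τ = E ⊗_L M` through the right factor
(`ρ a (y ⊗ m) = y ⊗ a·m`; trace commutes with base change). [cite: MilneCM2006, Ch. I §1 Prop. 1.21 (5)] -/
theorem trace_relReg [Module.Finite L M] (ρ : M →+* Module.End E (E ⊗[L] M))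
    (hρ : ∀ (a : M) (y : E) (m : M), ρ a (y ⊗ₜ[L] m) = y ⊗ₜ[L] (a * m)) (a : M) :
    LinearMap.trace E (E ⊗[L] M) (ρ a) = algebraMap L E (Algebra.trace L M a) := by
  have h : (ρ a : E ⊗[L] M →ₗ[E] E ⊗[L] M) = LinearMap.baseChange E ((Algebra.lmul L M) a) := by
    refine TensorProduct.AlgebraTensorModule.ext fun y m => ?_
    rw [hρ, LinearMap.baseChange_tmul]
    rfl
  rw [h, LinearMap.trace_baseChange, Algebra.trace_apply]

/-- **`det_{M⊗R}(x | V_τ ⊗ R) = (1 ⊗ j)(Nm_{E/L}(R) x)`**: the coordinate determinant over `M` of the `E`-module `V_τ = E ⊗_L M`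
(regarded over `M` through the right factor, `ρ a (y ⊗ m) = y ⊗ a·m`) on `R`-points is the relative norm `Nm_{E/L}` on points
(★ `normPoints L E R`) pushed along `j = algebraMap L M` — in any `M`-basis (★ `baseChangeDet_eq_of_basis`).  Proof:
`V_τ ≅ M ⊗_L E` over `M`, where `c ∈ E` acts by `1 ⊗ (mult. by c)`, whose matrix in the basis `1 ⊗ b` is `[c]_b` read in `M`
(Mathlib `LinearMap.toMatrix_baseChange`). [cite: MilneCM2006, Ch. I §1 Prop. 1.23 (7), Rem. 1.25] -/
theorem baseChangeDet_relReg [CharZero L] [Algebra ℚ E] [Module.Finite L E] [Algebra ℚ M]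
    (R : Type) [CommRing R] [Algebra ℚ R] (ρ : M →+* Module.End E (E ⊗[L] M))
    (hρ : ∀ (a : M) (y : E) (m : M), ρ a (y ⊗ₜ[L] m) = y ⊗ₜ[L] (a * m))
    {ι : Type} [Fintype ι] [DecidableEq ι] (bτ : Basis ι M (ActionSpace ρ)) (x : R ⊗[ℚ] E) :
    baseChangeDet bτ (scalarEndRingHom ρ) R x =
      Algebra.TensorProduct.map (AlgHom.id R R) (algebraMap L M).toRatAlgHom (normPoints L E R x) := by
  classical
  -- the action of `E` on `M ⊗_L E` through the right factor
  let θ : E →+* Module.End M (M ⊗[L] E) := ((Algebra.lmul M (M ⊗[L] E)) : M ⊗[L] E →+* Module.End M (M ⊗[L] E)).comp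
      ((Algebra.TensorProduct.includeRight : E →ₐ[L] M ⊗[L] E) : E →+* M ⊗[L] E)
  have hθ_tmul : ∀ (c : E) (m : M) (y : E), (θ c : M ⊗[L] E →ₗ[M] M ⊗[L] E) (m ⊗ₜ y) = m ⊗ₜ (c * y) := by
    intro c m y
    change ((1 : M) ⊗ₜ[L] c) * (m ⊗ₜ[L] y) = _
    rw [Algebra.TensorProduct.tmul_mul_tmul, one_mul]
  -- `M ⊗_L E ≅ V_τ` over `M` (the flip), intertwining the two `E`-actions
  let ec : (M ⊗[L] E) ≃ₗ[M] ActionSpace ρ :=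
    { (TensorProduct.comm L M E : M ⊗[L] E ≃ₗ[L] E ⊗[L] M).toAddEquiv with
      map_smul' := fun a v => by
        change TensorProduct.comm L M E (a • v) = a • (show ActionSpace ρ from TensorProduct.comm L M E v)
        rw [ActionSpace.smul_def]
        induction v using TensorProduct.induction_on with
        | zero => rw [smul_zero, map_zero, map_zero]
        | tmul m y => rw [TensorProduct.smul_tmul', TensorProduct.comm_tmul, TensorProduct.comm_tmul, hρ, smul_eq_mul]
        | add v w hv hw => rw [smul_add, map_add, hv, hw, map_add, map_add] }
  have hcomm : ∀ (c : E) (v : M ⊗[L] E), ec (θ c v) = scalarEndRingHom ρ c (ec v) := by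
    intro c v
    rw [scalarEndRingHom_apply, scalarEnd_apply]
    change TensorProduct.comm L M E (θ c v) = c • (TensorProduct.comm L M E v : E ⊗[L] M)
    induction v using TensorProduct.induction_on with
    | zero => rw [map_zero, map_zero, smul_zero]
    | tmul m y => rw [hθ_tmul, TensorProduct.comm_tmul, TensorProduct.comm_tmul, TensorProduct.smul_tmul', smul_eq_mul]
    | add v w hv hw => rw [map_add, map_add, hv, hw, map_add, smul_add]
  -- an `L`-basis `b` of `E`; the `M`-basis `1 ⊗ b` of `M ⊗_L E`
  let b := Module.finBasis L E
  let b' : Basis (Fin (Module.finrank L E)) M (M ⊗[L] E) := Algebra.TensorProduct.basis M b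
  -- the coordinate action of `x ∈ R ⊗ E` on `M ⊗_L E` is that on `E`, read in `M`
  have hrep : ∀ z : R ⊗[ℚ] E, baseChangeRep b' θ R z =
      (Algebra.TensorProduct.map (AlgHom.id R R) (algebraMap L M).toRatAlgHom).mapMatrix
        (baseChangeRep b ((Algebra.lmul L E : E →ₐ[L] Module.End L E) : E →+* Module.End L E) R z) := by
    intro z
    induction z using TensorProduct.induction_on with
    | zero => rw [map_zero, map_zero, map_zero]
    | tmul r c =>
        have hθc : (θ c : M ⊗[L] E →ₗ[M] M ⊗[L] E) = LinearMap.baseChange M ((Algebra.lmul L E) c) := by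
          refine TensorProduct.AlgebraTensorModule.ext fun m y => ?_
          rw [hθ_tmul, LinearMap.baseChange_tmul]
          rfl
        rw [baseChangeRep_tmul, baseChangeRep_tmul, hθc, LinearMap.toMatrix_baseChange, AlgHom.mapMatrix_apply,
          Matrix.map_map, Matrix.map_map]
        refine Matrix.ext fun i i' => ?_
        simp only [Matrix.map_apply, Function.comp_apply, Algebra.TensorProduct.map_tmul, AlgHom.id_apply]
        rfl
    | add z w hz hw => rw [map_add, map_add, map_add, hz, hw]
  calc baseChangeDet bτ (scalarEndRingHom ρ) R x
      = baseChangeDet (b'.map ec) (scalarEndRingHom ρ) R x := by rw [baseChangeDet_eq_of_basis (b'.map ec) _ R bτ]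
    _ = baseChangeDet b' θ R x := by rw [baseChangeDet_basisMap b' θ R ec (scalarEndRingHom ρ) hcomm]
    _ = Algebra.TensorProduct.map (AlgHom.id R R) (algebraMap L M).toRatAlgHom
          (baseChangeDet b ((Algebra.lmul L E : E →ₐ[L] Module.End L E) : E →+* Module.End L E) R x) := by
        rw [baseChangeDet_apply, baseChangeDet_apply, hrep, ← AlgHom.map_det]
    _ = Algebra.TensorProduct.map (AlgHom.id R R) (algebraMap L M).toRatAlgHom (normPoints L E R x) := by
        rw [baseChangeDet_lmul_eq_normPoints]

end RelReg

/-! ### §2. Traces: `Tr(V_τ) = Σ_{ρ∘j=τ} ρ`, `Tr(V_τ^c) = Σ_{ρ∘j=τ̄} ρ`, and the multiset identity `Φ + τ̄-block = Ψ + τ-block` -/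

section Traces

open NumberField NumberField.ComplexEmbedding

variable {L : Type} [Field L] {M : Type} [Field M] [NumberField M] [Algebra L M]

open scoped Classical in
/-- **`τ(Tr_{M/L} a) = Σ_{ρ : M → ℂ, ρ∘j = τ} ρ(a)`** (Mathlib `trace_eq_sum_embeddings`, re-indexed by ring maps extending
`τ` along `j = algebraMap L M`). [cite: MilneCM2006, Ch. I §1 Prop. 1.21 (5)] -/
theorem apply_trace_eq_sum_filter [FiniteDimensional L M] [Algebra.IsSeparable L M] (τ : L →+* ℂ) (a : M) :
    τ (Algebra.trace L M a) =
      ∑ ρ ∈ Finset.univ.filter (fun ρ : M →+* ℂ => ρ.comp (algebraMap L M) = τ), ρ a := by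
  classical
  letI : Algebra L ℂ := τ.toAlgebra
  have h : algebraMap L ℂ (Algebra.trace L M a) = ∑ σ : M →ₐ[L] ℂ, σ a := trace_eq_sum_embeddings ℂ
  rw [RingHom.algebraMap_toAlgebra] at h
  rw [h]
  refine Finset.sum_bij (fun (σ : M →ₐ[L] ℂ) _ => (σ : M →+* ℂ)) (fun σ _ => ?_) (fun σ _ σ' _ hσ => ?_)
    (fun ρ hρ => ?_) (fun σ _ => rfl)
  · rw [Finset.mem_filter]
    exact ⟨Finset.mem_univ _, RingHom.ext fun x => σ.commutes x⟩
  · exact AlgHom.coe_ringHom_injective hσ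
  · rw [Finset.mem_filter] at hρ
    refine ⟨{ (ρ : M →+* ℂ) with commutes' := fun x => ?_ }, Finset.mem_univ _, RingHom.ext fun _ => rfl⟩
    change ρ (algebraMap L M x) = τ x
    rw [← RingHom.comp_apply, hρ.2]

omit [Algebra L M] in
open scoped Classical in
/-- Re-indexing the `τ`-block by complex conjugation: `Σ_{ρ∘j=τ} ρ(c a) = Σ_{ρ∘j=τ̄} ρ(a)` for a CM field `M`
(`ρ ∘ c_M = conj ∘ ρ`, Mathlib `complexEmbedding_complexConj`). [cite: MilneCM2006, Ch. I §1 Rem. 1.24 (a)] -/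
theorem sum_filter_comp_complexConj [IsCMField M] (j : L →+* M) (τ : L →+* ℂ) (a : M) :
    ∑ ρ ∈ Finset.univ.filter (fun ρ : M →+* ℂ => ρ.comp j = τ), ρ (IsCMField.complexConj M a) =
      ∑ ρ ∈ Finset.univ.filter (fun ρ : M →+* ℂ => ρ.comp j = conjugate τ), ρ a := by
  classical
  have hcc : ∀ ρ : M →+* ℂ, conjugate (conjugate ρ) = ρ := fun ρ =>
    RingHom.ext fun x => by rw [conjugate_coe_eq, conjugate_coe_eq, Complex.conj_conj]
  have hccL : ∀ ρ : L →+* ℂ, conjugate (conjugate ρ) = ρ := fun ρ =>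
    RingHom.ext fun x => by rw [conjugate_coe_eq, conjugate_coe_eq, Complex.conj_conj]
  have hcomp : ∀ ρ : M →+* ℂ, (conjugate ρ).comp j = conjugate (ρ.comp j) := fun ρ => RingHom.ext fun x => rfl
  refine Finset.sum_bij' (fun ρ _ => conjugate ρ) (fun ρ _ => conjugate ρ) (fun ρ hρ => ?_) (fun ρ hρ => ?_)
    (fun ρ _ => hcc ρ) (fun ρ _ => hcc ρ) (fun ρ _ => ?_)
  · rw [Finset.mem_filter] at hρ ⊢
    exact ⟨Finset.mem_univ _, by rw [hcomp, hρ.2]⟩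
  · rw [Finset.mem_filter] at hρ ⊢
    exact ⟨Finset.mem_univ _, by rw [hcomp, hρ.2, hccL]⟩
  · rw [conjugate_coe_eq, IsCMField.complexEmbedding_complexConj]

omit [Algebra L M] in
open scoped Classical in
/-- **The multiset identity behind the swap**: for a `τ`-ADAPTED CM type `Φ` of the CM field `M` (every `ρ` over `τ` lies
in `Φ`) and its `τ`-swap `Ψ` (`ρ ∈ Ψ ↔ (ρ ∈ Φ ∧ ρ∘j ≠ τ) ∨ ρ∘j = τ̄`):
`Σ_{Φ} ρ(a) + Σ_{ρ∘j=τ̄} ρ(a) = Σ_{Ψ} ρ(a) + Σ_{ρ∘j=τ} ρ(a)` — both sides are `Σ_{Φ, ∘j≠τ} + Σ_{∘j=τ} + Σ_{∘j=τ̄}`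
(no `ρ ∈ Φ` lies over `τ̄`: its conjugate would lie over `τ`, hence in `Φ`). [cite: MilneCM2006, Ch. I §1 Rem. 1.24 (b)]
[cite: Milne2005ShimuraVarieties, Def. 12.8 (60) p. 114] -/
theorem cmTypeTrace_add_sum_filter_swap (j : L →+* M) (τ : L →+* ℂ) (Φ Ψ : CMType M)
    (hΦτ : ∀ ρ : M →+* ℂ, ρ.comp j = τ → ρ ∈ Φ.1)
    (hΨ : ∀ ρ : M →+* ℂ, ρ ∈ Ψ.1 ↔ (ρ ∈ Φ.1 ∧ ρ.comp j ≠ τ) ∨ ρ.comp j = conjugate τ) (a : M) :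
    cmTypeTrace Φ a + ∑ ρ ∈ Finset.univ.filter (fun ρ : M →+* ℂ => ρ.comp j = conjugate τ), ρ a =
      cmTypeTrace Ψ a + ∑ ρ ∈ Finset.univ.filter (fun ρ : M →+* ℂ => ρ.comp j = τ), ρ a := by
  classical
  have hcomp : ∀ ρ : M →+* ℂ, (conjugate ρ).comp j = conjugate (ρ.comp j) := fun ρ => RingHom.ext fun x => rfl
  have hccL : ∀ ρ : L →+* ℂ, conjugate (conjugate ρ) = ρ := fun ρ =>
    RingHom.ext fun x => by rw [conjugate_coe_eq, conjugate_coe_eq, Complex.conj_conj]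
  -- no member of `Φ` lies over `τ̄`
  have hΦτbar : ∀ ρ : M →+* ℂ, ρ.comp j = conjugate τ → ρ ∉ Φ.1 := by
    intro ρ hρ hmem
    have h1 : (conjugate ρ).comp j = τ := by rw [hcomp, hρ, hccL]
    exact ((Φ.2 ρ).1 hmem) (hΦτ _ h1)
  have htoF : ∀ Θ : CMType M, cmTypeTrace Θ a = ∑ ρ ∈ Finset.univ.filter (fun ρ : M →+* ℂ => ρ ∈ Θ.1), ρ a := by
    intro Θ
    rw [cmTypeTrace_apply]
    refine Finset.sum_congr ?_ fun _ _ => rfl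
    ext ρ
    rw [Set.Finite.mem_toFinset, Finset.mem_filter]
    exact ⟨fun h => ⟨Finset.mem_univ _, h⟩, fun h => h.2⟩
  -- split `Φ` and `Ψ` along the `τ`-block / `τ̄`-block
  have hΦsplit : Finset.univ.filter (fun ρ : M →+* ℂ => ρ ∈ Φ.1) =
      Finset.univ.filter (fun ρ : M →+* ℂ => ρ ∈ Φ.1 ∧ ρ.comp j ≠ τ) ∪
        Finset.univ.filter (fun ρ : M →+* ℂ => ρ.comp j = τ) := by
    ext ρ
    simp only [Finset.mem_filter, Finset.mem_union, Finset.mem_univ, true_and]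
    constructor
    · intro h
      by_cases hc : ρ.comp j = τ
      · exact Or.inr hc
      · exact Or.inl ⟨h, hc⟩
    · rintro (⟨h, -⟩ | h)
      · exact h
      · exact hΦτ ρ h
  have hΨsplit : Finset.univ.filter (fun ρ : M →+* ℂ => ρ ∈ Ψ.1) =
      Finset.univ.filter (fun ρ : M →+* ℂ => ρ ∈ Φ.1 ∧ ρ.comp j ≠ τ) ∪
        Finset.univ.filter (fun ρ : M →+* ℂ => ρ.comp j = conjugate τ) := by
    ext ρ
    simp only [Finset.mem_filter, Finset.mem_union, Finset.mem_univ, true_and]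
    exact hΨ ρ
  have hdisjΦ : Disjoint (Finset.univ.filter (fun ρ : M →+* ℂ => ρ ∈ Φ.1 ∧ ρ.comp j ≠ τ))
      (Finset.univ.filter (fun ρ : M →+* ℂ => ρ.comp j = τ)) :=
    Finset.disjoint_filter.2 fun ρ _ h hc => h.2 hc
  have hdisjΨ : Disjoint (Finset.univ.filter (fun ρ : M →+* ℂ => ρ ∈ Φ.1 ∧ ρ.comp j ≠ τ))
      (Finset.univ.filter (fun ρ : M →+* ℂ => ρ.comp j = conjugate τ)) :=
    Finset.disjoint_filter.2 fun ρ _ h hc => hΦτbar ρ hc h.1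
  rw [htoF Φ, htoF Ψ, hΦsplit, hΨsplit, Finset.sum_union hdisjΦ, Finset.sum_union hdisjΨ]
  ring

end Traces

/-! ### §3. The swap identity on `R`-points: `N_Φ(x) · (1 ⊗ c∘j)(Nm_{E/L} x) = N_Ψ(x) · (1 ⊗ j)(Nm_{E/L} x)` -/

section Swap

open NumberField NumberField.ComplexEmbedding

set_option synthInstance.maxHeartbeats 400000 in
set_option maxHeartbeats 1600000 in
/-- **THE `τ`-SWAP IDENTITY ON `R`-POINTS** ([MilneCM2006] Ch. I §1 Rem. 1.24/1.25 for the pair of CM types `(Φ, Φ^τ̄)`;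
[Milne2005ShimuraVarieties] (60)–(61) with `μ = [τ̄] − [τ]`).  Let `M` be a CM field over `L` (`j = algebraMap L M`),
`E ⊂ ℂ` a number field which is an `L`-algebra through `τ : L → ℂ` (`hτ`), `Φ` a `τ`-ADAPTED CM type of `M` (every `ρ`
with `ρ∘j = τ` lies in `Φ`), `Ψ` its `τ`-swap (`ρ ∈ Ψ ↔ (ρ ∈ Φ ∧ ρ∘j ≠ τ) ∨ ρ∘j = τ̄`), `E ⊇ E*(Φ), E*(Ψ)`.  Then for
EVERY commutative `ℚ`-algebra `R` and every `x ∈ R ⊗_ℚ E`: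
`N_{E,Φ}(R)(x) · (1 ⊗ c_M)((1 ⊗ j)(Nm_{E/L}(R) x)) = N_{E,Ψ}(R)(x) · (1 ⊗ j)(Nm_{E/L}(R) x)` (★ `reflexNormPoints`,
★ `normPoints`, ★ `conjPoints`).  PROOF: the `E`-modules with `M`-action `V_Φ ⊕ V_τ^c` and `V_Ψ ⊕ V_τ` (`V_τ = E ⊗_L M`,
`V_τ^c` its twist by `c_M`) have the same traces (§2), hence are `M ⊗ E`-isomorphic (★ Prop. 1.21 uniqueness
`exists_equiv_of_trace_eq`); take `det_{M⊗R}` (★ `baseChangeDet_prod`, `baseChangeDet_twist`, `baseChangeDet_basisMap`, §1).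
[cite: MilneCM2006, Ch. I §1 Prop. 1.21, Rem. 1.24 (a)–(b), Rem. 1.25] [cite: Milne2005ShimuraVarieties, Def. 12.8 (60)–(61) p. 114] -/
theorem reflexNormPoints_swap {L : Type} [Field L] [NumberField L] (M : Type) [Field M] [NumberField M] [IsCMField M]
    [Algebra L M] [Module.Finite L M] (Φ Ψ : CMType M) (E : IntermediateField ℚ ℂ) [FiniteDimensional ℚ E]
    [Algebra L E] [Module.Finite L E] (τ : L →+* ℂ) (hτ : ∀ x : L, ((algebraMap L E x : E) : ℂ) = τ x)
    (hΦE : traceField Φ ≤ E) (hΨE : traceField Ψ ≤ E)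
    (hΦτ : ∀ ρ : M →+* ℂ, ρ.comp (algebraMap L M) = τ → ρ ∈ Φ.1)
    (hΨ : ∀ ρ : M →+* ℂ, ρ ∈ Ψ.1 ↔ (ρ ∈ Φ.1 ∧ ρ.comp (algebraMap L M) ≠ τ) ∨ ρ.comp (algebraMap L M) = conjugate τ)
    (R : Type) [CommRing R] [Algebra ℚ R] (x : R ⊗[ℚ] E) :
    reflexNormPoints M Φ E R x *
        conjPoints M R (Algebra.TensorProduct.map (AlgHom.id R R) (algebraMap L M).toRatAlgHom (normPoints L E R x)) =
      reflexNormPoints M Ψ E R x *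
        Algebra.TensorProduct.map (AlgHom.id R R) (algebraMap L M).toRatAlgHom (normPoints L E R x) := by
  classical
  haveI : Algebra.IsSeparable L M := Algebra.IsSeparable.of_integral L M
  -- the four represented modules
  let ρΦ : M →+* Module.End E (traceModule (cmTypeEquivCMTypeOn M Φ) E) := traceModuleAct (cmTypeEquivCMTypeOn M Φ) E
  let ρΨ : M →+* Module.End E (traceModule (cmTypeEquivCMTypeOn M Ψ) E) := traceModuleAct (cmTypeEquivCMTypeOn M Ψ) E
  let ρτ : M →+* Module.End E (E ⊗[L] M) := ((Algebra.lmul E (E ⊗[L] M)) : E ⊗[L] M →+* Module.End E (E ⊗[L] M)).comp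
      ((Algebra.TensorProduct.includeRight : M →ₐ[L] E ⊗[L] M) : M →+* E ⊗[L] M)
  have hρτ : ∀ (a : M) (y : E) (m : M), ρτ a (y ⊗ₜ[L] m) = y ⊗ₜ[L] (a * m) := by
    intro a y m
    change ((1 : E) ⊗ₜ[L] a) * (y ⊗ₜ[L] m) = _
    rw [Algebra.TensorProduct.tmul_mul_tmul, one_mul]
  let σ : M ≃+* M := (IsCMField.complexConj M).toRingEquiv
  have hkΦ : reflexFieldOn (cmTypeEquivCMTypeOn M Φ) ≤ E := by rwa [reflexFieldOn_cmTypeEquivCMTypeOn]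
  have hkΨ : reflexFieldOn (cmTypeEquivCMTypeOn M Ψ) ≤ E := by rwa [reflexFieldOn_cmTypeEquivCMTypeOn]
  -- the traces, read in `ℂ`
  have htrτ : ∀ a : M, ((LinearMap.trace E (E ⊗[L] M) (ρτ a) : E) : ℂ) =
      ∑ ρ ∈ Finset.univ.filter (fun ρ : M →+* ℂ => ρ.comp (algebraMap L M) = τ), ρ a := by
    intro a
    rw [trace_relReg ρτ hρτ a, hτ, apply_trace_eq_sum_filter]
  have htr : ∀ a : M, LinearMap.trace E _ (prodAct ρΦ (ρτ.comp (σ : M →+* M)) a) =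
      LinearMap.trace E _ (prodAct ρΨ ρτ a) := by
    intro a
    apply (algebraMap E ℂ).injective
    rw [prodAct_apply, LinearMap.trace_prodMap', map_add, prodAct_apply, LinearMap.trace_prodMap', map_add,
      RingHom.comp_apply, algebraMap_trace_traceModuleAct _ E hkΦ, algebraMap_trace_traceModuleAct _ E hkΨ,
      cmTraceOn_cmTypeEquivCMTypeOn, cmTraceOn_cmTypeEquivCMTypeOn]
    change cmTypeTrace Φ a + ((LinearMap.trace E (E ⊗[L] M) (ρτ (IsCMField.complexConj M a)) : E) : ℂ) =
      cmTypeTrace Ψ a + ((LinearMap.trace E (E ⊗[L] M) (ρτ a) : E) : ℂ)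
    rw [htrτ, htrτ, sum_filter_comp_complexConj (algebraMap L M) τ a,
      cmTypeTrace_add_sum_filter_swap (algebraMap L M) τ Φ Ψ hΦτ hΨ a]
  -- Prop. 1.21: the two modules are `M ⊗ E`-isomorphic
  obtain ⟨e, he⟩ := exists_equiv_of_trace_eq _ _ htr
  let e' : ActionSpace (prodAct ρΦ (ρτ.comp (σ : M →+* M))) ≃ₗ[M] ActionSpace (prodAct ρΨ ρτ) :=
    ActionSpace.congr _ _ e he
  have he' : ∀ (c : E) (v : ActionSpace (prodAct ρΦ (ρτ.comp (σ : M →+* M)))),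
      e' (scalarEndRingHom (prodAct ρΦ (ρτ.comp (σ : M →+* M))) c v) = scalarEndRingHom (prodAct ρΨ ρτ) c (e' v) :=
    fun c v => map_smul e c (v : _ × _)
  -- bases
  let bΦ := Module.finBasis M (ActionSpace ρΦ)
  let bΨ := Module.finBasis M (ActionSpace ρΨ)
  let bτ := Module.finBasis M (ActionSpace ρτ)
  -- determinants
  have hdet : baseChangeDet bΦ (scalarEndRingHom ρΦ) R x *
      baseChangeDet (twistBasis ρτ σ bτ) (scalarEndRingHom (ρτ.comp (σ : M →+* M))) R x =
        baseChangeDet bΨ (scalarEndRingHom ρΨ) R x * baseChangeDet bτ (scalarEndRingHom ρτ) R x := by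
    rw [← baseChangeDet_prod ρΦ (ρτ.comp (σ : M →+* M)) R bΦ (twistBasis ρτ σ bτ) x,
      ← baseChangeDet_prod ρΨ ρτ R bΨ bτ x,
      ← baseChangeDet_basisMap _ _ R e' (scalarEndRingHom (prodAct ρΨ ρτ)) he',
      baseChangeDet_eq_of_basis (((bΨ.prod bτ).map (prodEquiv ρΨ ρτ).symm)) (scalarEndRingHom (prodAct ρΨ ρτ)) R _]
  rw [baseChangeDet_twist ρτ σ R bτ x, complexConj_symm_eq, baseChangeDet_relReg R ρτ hρτ bτ x] at hdet
  rw [reflexNormPoints_def, reflexNormPoints_def]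
  exact hdet

end Swap

/-! ### §4. `R = 𝔸_{ℚ,f}`: the swap identity on finite adèles and finite idèles -/

section Finite

open NumberField NumberField.ComplexEmbedding

/-- **`e_F⁻¹(N_{k/F,f} y) = Nm_{k/F}(𝔸_{ℚ,f})(e_k⁻¹ y)`**: the norm on finite adèles (★ `finiteAdeleRelNorm`, [CasselsFrohlichANT1967]
(19.7) at the finite places) read on `𝔸_{ℚ,f}`-points is the norm of tori `Nm_{k/F}` on `𝔸_{ℚ,f}`-points (★ `normPoints`) — the
finite component of ★ `ratAdeleTensorEquiv_symm_adeleRelNorm` (through ★ `snd_adeleRelNorm`, ★ `ratAdeleTensorEquiv_snd`,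
★ `normPoints_map` along `pr_f`, ★ `map_snd_ratAdeleTensorEquiv_symm`).
[cite: MilneCM2006, Ch. I §1 Rem. 1.25] [cite: CasselsFrohlichANT1967, Ch. II §19 (19.7), (19.15)–(19.17)] -/
theorem ratFiniteAdeleTensorEquiv_symm_finiteAdeleRelNorm (F k : Type) [Field F] [NumberField F] [Field k] [NumberField k]
    [Algebra F k] (y : FiniteAdeleRing (𝓞 k) k) :
    (ratFiniteAdeleTensorEquiv F).symm (finiteAdeleRelNorm F k y) =
      normPoints F k (FiniteAdeleRing (𝓞 ℚ) ℚ) ((ratFiniteAdeleTensorEquiv k).symm y) := by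
  have h1 : finiteAdeleRelNorm F k y = (adeleRelNorm F k ((1, y) : AdeleRing (𝓞 k) k)).2 :=
    (snd_adeleRelNorm F k ((1, y) : AdeleRing (𝓞 k) k)).symm
  have h2 : adeleRelNorm F k ((1, y) : AdeleRing (𝓞 k) k) =
      ratAdeleTensorEquiv F (normPoints F k (AdeleRing (𝓞 ℚ) ℚ) ((ratAdeleTensorEquiv k).symm ((1, y) : AdeleRing (𝓞 k) k))) := by
    rw [← ratAdeleTensorEquiv_symm_adeleRelNorm, RingEquiv.apply_symm_apply]
  rw [RingEquiv.symm_apply_eq, h1, h2, ratAdeleTensorEquiv_snd, ← normPoints_map, map_snd_ratAdeleTensorEquiv_symm]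

variable {L : Type} [Field L] [NumberField L] [IsCMField L] (M : Type) [Field M] [NumberField M] [IsCMField M]
  [Algebra L M]

omit [IsCMField L] [IsCMField M] in
/-- **The push-forward `ĵ : 𝔸_{L,f} → 𝔸_{M,f}` read on points**: `e_M((1 ⊗ j)(e_L⁻¹ ·))` is a ring homomorphism; its value on a
product. [cite: CasselsFrohlichANT1967, Ch. II §14 Lemma (14.2)] -/
theorem ratFiniteAdeleTensorEquiv_map_symm_mul (w w' : FiniteAdeleRing (𝓞 L) L) :
    ratFiniteAdeleTensorEquiv M (Algebra.TensorProduct.map (AlgHom.id (FiniteAdeleRing (𝓞 ℚ) ℚ) (FiniteAdeleRing (𝓞 ℚ) ℚ))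
        (algebraMap L M).toRatAlgHom ((ratFiniteAdeleTensorEquiv L).symm (w * w'))) =
      ratFiniteAdeleTensorEquiv M (Algebra.TensorProduct.map (AlgHom.id (FiniteAdeleRing (𝓞 ℚ) ℚ) (FiniteAdeleRing (𝓞 ℚ) ℚ))
        (algebraMap L M).toRatAlgHom ((ratFiniteAdeleTensorEquiv L).symm w)) *
      ratFiniteAdeleTensorEquiv M (Algebra.TensorProduct.map (AlgHom.id (FiniteAdeleRing (𝓞 ℚ) ℚ) (FiniteAdeleRing (𝓞 ℚ) ℚ))
        (algebraMap L M).toRatAlgHom ((ratFiniteAdeleTensorEquiv L).symm w')) := by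
  rw [map_mul, map_mul, map_mul]

/-- **Complex conjugation commutes with the push-forward along an embedding of CM fields**: `(ĵ w)^{c_M} = ĵ(w^{c_L})` on finite adèles
(`c_M ∘ j = j ∘ c_L`, Mathlib `complexEmbedding_complexConj` through any complex embedding of `M`).
[cite: MilneCM2006, Ch. II §9, Lemma 9.7] -/
theorem finiteAdeleComplexConj_ratFiniteAdeleTensorEquiv_map (w : FiniteAdeleRing (𝓞 L) L) :
    finiteAdeleComplexConj M (ratFiniteAdeleTensorEquiv M (Algebra.TensorProduct.map
        (AlgHom.id (FiniteAdeleRing (𝓞 ℚ) ℚ) (FiniteAdeleRing (𝓞 ℚ) ℚ)) (algebraMap L M).toRatAlgHom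
        ((ratFiniteAdeleTensorEquiv L).symm w))) =
      ratFiniteAdeleTensorEquiv M (Algebra.TensorProduct.map (AlgHom.id (FiniteAdeleRing (𝓞 ℚ) ℚ) (FiniteAdeleRing (𝓞 ℚ) ℚ))
        (algebraMap L M).toRatAlgHom ((ratFiniteAdeleTensorEquiv L).symm (finiteAdeleComplexConj L w))) := by
  -- `c_M ∘ j = j ∘ c_L` on `M`
  have hcj : ∀ x : L, IsCMField.complexConj M (algebraMap L M x) = algebraMap L M (IsCMField.complexConj L x) := by
    intro x
    obtain ⟨φ⟩ := (inferInstance : Nonempty (M →+* ℂ))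
    apply φ.injective
    rw [IsCMField.complexEmbedding_complexConj]
    exact (IsCMField.complexEmbedding_complexConj L (φ.comp (algebraMap L M)) x).symm
  -- on points: `conjPoints M ∘ (1 ⊗ j) = (1 ⊗ j) ∘ conjPoints L`
  have hpts : ∀ z : FiniteAdeleRing (𝓞 ℚ) ℚ ⊗[ℚ] L,
      conjPoints M (FiniteAdeleRing (𝓞 ℚ) ℚ) (Algebra.TensorProduct.map
          (AlgHom.id (FiniteAdeleRing (𝓞 ℚ) ℚ) (FiniteAdeleRing (𝓞 ℚ) ℚ)) (algebraMap L M).toRatAlgHom z) =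
        Algebra.TensorProduct.map (AlgHom.id (FiniteAdeleRing (𝓞 ℚ) ℚ) (FiniteAdeleRing (𝓞 ℚ) ℚ))
          (algebraMap L M).toRatAlgHom (conjPoints L (FiniteAdeleRing (𝓞 ℚ) ℚ) z) := by
    intro z
    induction z using TensorProduct.induction_on with
    | zero => simp only [map_zero]
    | tmul r a =>
        rw [Algebra.TensorProduct.map_tmul, conjPoints_tmul, conjPoints_tmul, Algebra.TensorProduct.map_tmul,
          AlgHom.id_apply]
        change r ⊗ₜ IsCMField.complexConj M (algebraMap L M a) = r ⊗ₜ algebraMap L M (IsCMField.complexConj L a)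
        rw [hcj]
    | add z z' hz hz' => simp only [map_add, hz, hz']
  rw [finiteAdeleComplexConj_apply, RingEquiv.symm_apply_apply, hpts, finiteAdeleComplexConj_apply,
    RingEquiv.symm_apply_apply]

omit [IsCMField L] in
/-- **THE `τ`-SWAP IDENTITY ON FINITE ADÈLES**: `N_{E,Φ,f}(y) · (ĵ N_{E/L,f}(y))^{c_M} = N_{E,Ψ,f}(y) · ĵ N_{E/L,f}(y)` for every
`y ∈ 𝔸_{E,f}` (★ `reflexNormFiniteAdele`, ★ `finiteAdeleRelNorm`, ★ `finiteAdeleComplexConj`; `ĵ = e_M ∘ (1 ⊗ j) ∘ e_L⁻¹` the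
push-forward of finite adèles along `j`) — `reflexNormPoints_swap` at `R = 𝔸_{ℚ,f}` read through `𝔸_{ℚ,f} ⊗ · ≅ 𝔸_{·,f}`.
[cite: MilneCM2006, Ch. I §1 Rem. 1.24 (b), Rem. 1.25] [cite: Milne2005ShimuraVarieties, Def. 12.8 (60)–(61) p. 114] -/
theorem reflexNormFiniteAdele_swap [Module.Finite L M] (Φ Ψ : CMType M) (E : IntermediateField ℚ ℂ) [NumberField E]
    [Algebra L E] [Module.Finite L E] (τ : L →+* ℂ) (hτ : ∀ x : L, ((algebraMap L E x : E) : ℂ) = τ x)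
    (hΦE : traceField Φ ≤ E) (hΨE : traceField Ψ ≤ E)
    (hΦτ : ∀ ρ : M →+* ℂ, ρ.comp (algebraMap L M) = τ → ρ ∈ Φ.1)
    (hΨ : ∀ ρ : M →+* ℂ, ρ ∈ Ψ.1 ↔ (ρ ∈ Φ.1 ∧ ρ.comp (algebraMap L M) ≠ τ) ∨ ρ.comp (algebraMap L M) = conjugate τ)
    (y : FiniteAdeleRing (𝓞 E) E) :
    reflexNormFiniteAdele M Φ E y *
        finiteAdeleComplexConj M (ratFiniteAdeleTensorEquiv M (Algebra.TensorProduct.map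
          (AlgHom.id (FiniteAdeleRing (𝓞 ℚ) ℚ) (FiniteAdeleRing (𝓞 ℚ) ℚ)) (algebraMap L M).toRatAlgHom
          ((ratFiniteAdeleTensorEquiv L).symm (finiteAdeleRelNorm L E y)))) =
      reflexNormFiniteAdele M Ψ E y *
        ratFiniteAdeleTensorEquiv M (Algebra.TensorProduct.map
          (AlgHom.id (FiniteAdeleRing (𝓞 ℚ) ℚ) (FiniteAdeleRing (𝓞 ℚ) ℚ)) (algebraMap L M).toRatAlgHom
          ((ratFiniteAdeleTensorEquiv L).symm (finiteAdeleRelNorm L E y))) := by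
  have h := reflexNormPoints_swap M Φ Ψ E τ hτ hΦE hΨE hΦτ hΨ (FiniteAdeleRing (𝓞 ℚ) ℚ)
    ((ratFiniteAdeleTensorEquiv E).symm y)
  rw [reflexNormFiniteAdele_apply, reflexNormFiniteAdele_apply, finiteAdeleComplexConj_apply, RingEquiv.symm_apply_apply,
    ratFiniteAdeleTensorEquiv_symm_finiteAdeleRelNorm, ← map_mul, ← map_mul, h]

/-- **S4b-2 — THE `τ`-SWAP IDENTITY ON FINITE IDÈLES (consumer form)**: for a finite idèle `s` of `E`, with
`N′ := N_{E/L,f}(s) ∈ 𝔸_{L,f}^×` (★ `finiteIdeleRelNorm`):  `N_{E,Ψ,f}(s) = N_{E,Φ,f}(s) · ĵ((N′)^{c_L} · N′⁻¹)` in `𝔸_{M,f}` —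
[Milne2005ShimuraVarieties] (60)–(62): the reciprocity factor `r(s) = c(N′)/N′` of the torus `T₃` with `μ = [τ̄] − [τ]` (the I-1′ receptacle's
★ `UnitaryCanonicalModel.recipFactor (N′)`, via ★ `finiteAdeleComplexConj_eq_conjFiniteAdele`) accounts exactly for trading the
`τ`-block of `Φ` for the `τ̄`-block.  (`ĵ = e_M ∘ (1 ⊗ j) ∘ e_L⁻¹` = the receptacle's `e_M ∘ finAdeleToTensor M j`.)
[cite: Milne2005ShimuraVarieties, Def. 12.5 p. 113, Def. 12.8 (60)–(62) p. 114] [cite: MilneCM2006, Ch. I §1 Rem. 1.24 (b), Rem. 1.25] -/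
theorem reflexNormFiniteIdele_swap_tau [Module.Finite L M] (Φ Ψ : CMType M) (E : IntermediateField ℚ ℂ) [NumberField E]
    [Algebra L E] [Module.Finite L E] (τ : L →+* ℂ) (hτ : ∀ x : L, ((algebraMap L E x : E) : ℂ) = τ x)
    (hΦE : traceField Φ ≤ E) (hΨE : traceField Ψ ≤ E)
    (hΦτ : ∀ ρ : M →+* ℂ, ρ.comp (algebraMap L M) = τ → ρ ∈ Φ.1)
    (hΨ : ∀ ρ : M →+* ℂ, ρ ∈ Ψ.1 ↔ (ρ ∈ Φ.1 ∧ ρ.comp (algebraMap L M) ≠ τ) ∨ ρ.comp (algebraMap L M) = conjugate τ)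
    (s : (FiniteAdeleRing (𝓞 E) E)ˣ) :
    (reflexNormFiniteIdele M Ψ E s : FiniteAdeleRing (𝓞 M) M) =
      (reflexNormFiniteIdele M Φ E s : FiniteAdeleRing (𝓞 M) M) *
        ratFiniteAdeleTensorEquiv M (Algebra.TensorProduct.map
          (AlgHom.id (FiniteAdeleRing (𝓞 ℚ) ℚ) (FiniteAdeleRing (𝓞 ℚ) ℚ)) (algebraMap L M).toRatAlgHom
          ((ratFiniteAdeleTensorEquiv L).symm
            (finiteAdeleComplexConj L ((finiteIdeleRelNorm L E s : (FiniteAdeleRing (𝓞 L) L)ˣ) : FiniteAdeleRing (𝓞 L) L) *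
              ((finiteIdeleRelNorm L E s)⁻¹ : (FiniteAdeleRing (𝓞 L) L)ˣ)))) := by
  have h := reflexNormFiniteAdele_swap M Φ Ψ E τ hτ hΦE hΨE hΦτ hΨ (s : FiniteAdeleRing (𝓞 E) E)
  -- `N_{E/L,f}(s)` as a finite adèle is the finite idèle `finiteIdeleRelNorm L E s`
  have hN : finiteAdeleRelNorm L E (s : FiniteAdeleRing (𝓞 E) E) =
      ((finiteIdeleRelNorm L E s : (FiniteAdeleRing (𝓞 L) L)ˣ) : FiniteAdeleRing (𝓞 L) L) := rfl
  rw [hN, finiteAdeleComplexConj_ratFiniteAdeleTensorEquiv_map] at h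
  rw [coe_reflexNormFiniteIdele, coe_reflexNormFiniteIdele, ratFiniteAdeleTensorEquiv_map_symm_mul, ← mul_assoc, h,
    mul_assoc, ← ratFiniteAdeleTensorEquiv_map_symm_mul, Units.mul_inv, map_one, map_one, map_one, mul_one]

end Finite

end Literature.NumberTheory.ComplexMultiplication

end
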